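import Mathlib
import HarnessLib
import Summits.AtomisticToContinuum.FouriersLaw.Theses.JunctionLocality
import Summits.AtomisticToContinuum.FouriersLaw.Theorems.JunctionLocalityConductanceLowerBoundCertificateObstruction

/-!
# Quantitative two-ends obstruction: the loadings a floor certificate must carry
(crux stmt-AtomisticToContinuum-11749, line `ForecastSensitivitySketch`)

Helper file (`--supports stmt-AtomisticToContinuum-11749`, lead c5).  Setting as in `…CertificateObstruction`: admissible pairs `(φ, χ)` of
the `L`-chain (`L ≥ 2`), `γ S_B φ + X_H χ = −(p_0² − T)`; the GAIN of a pair is `T/γ² − cost(φ,χ)` (the trivial pair has gain `0`, the floor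
needs gain `≥ 2c/(L−1)`, `floor_of_certificates` / `certificates_of_floor`).  Since `cost ≥ ‖∂_{p_0}φ‖²`, the two pairing identities bound the gain
by the two LOADINGS of the pair:

* `certificate_gain_le_farLoading` — `T/γ² − ‖∂_{p_0}φ‖² ≤ (2/γ)·|⟨p_{L−1}, ∂_{p_{L−1}}φ⟩_{μ_T}|` (far dissipative loading of `φ`);
* `certificate_gain_le_nearCorrelation` — `T/γ² − ‖∂_{p_0}φ‖² ≤ (2/(γ²T))·⟨χ, −p_0 ∂_{q_0}H⟩_{μ_T}` (correlation of `χ` with the contact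
  kinetic-energy production `X_H(p_0²/2) = −p_0∂_{q_0}H`);
* `floorCertificate_loadings` — hence an admissible pair of cost `≤ T/γ² − c'/(L−1)` has `|⟨p_{L−1},∂_{p_{L−1}}φ⟩| ≥ γc'/(2(L−1))` and
  `⟨χ, −p_0∂_{q_0}H⟩ ≥ γ²Tc'/(2(L−1))`: both loadings of a floor certificate are at least of the order of the conductance `G_L ≍ 1/L` itself —
  the certificate must resolve the transmitted `1/L` share at BOTH contacts (quantitative form of the admissibility wall).

No new definitions, no named facts, no sorry.  References: folklore.
-/

noncomputable section

open MeasureTheory Filter Topology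
open scoped ContDiff
open Literature.MathematicalPhysics.KineticTheory.HeatConduction
open Summit.AtomisticToContinuum.FouriersLaw.Theorems.SuperadditiveResistance.DeviceLiouville (kin liouvilleOp bathOp)

namespace Summit.AtomisticToContinuum.FouriersLaw.Cruxes.ConductanceLowerBound.ForecastSensitivity

variable {ω₂ lam β γ T : ℝ}

/-- **Gain ≤ far loading.**  For `L ≥ 2` and every admissible pair `(φ, χ)`:
`T/γ² − ‖∂_{p_0}φ‖² ≤ (2/γ) |⟨p_{L−1}, ∂_{p_{L−1}}φ⟩_{μ_T}|` (from `γ(⟨p_0,∂_{p_0}φ⟩ + ⟨p_{L−1},∂_{p_{L−1}}φ⟩) = T` and Cauchy–Schwarz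
`⟨p_0,∂_{p_0}φ⟩² ≤ T‖∂_{p_0}φ‖²`). [folklore] -/
theorem certificate_gain_le_farLoading (hω : 0 < ω₂) (hl : 0 ≤ lam) (hβ : 0 ≤ β) (hγ : 0 < γ) (hT : 0 < T)
    {L : ℕ} (hL : 2 ≤ L) {φ χ : PhaseSpace L → ℝ} (hφ : ContDiff ℝ 2 φ) (hχ : ContDiff ℝ 2 χ)
    (hφ0 : MemLp (partialP (⟨0, by omega⟩ : Fin L) φ) 2 ((pinnedChain ω₂ lam β γ).gibbsMeasure L T))
    (hφR : MemLp (partialP (⟨L - 1, by omega⟩ : Fin L) φ) 2 ((pinnedChain ω₂ lam β γ).gibbsMeasure L T))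
    (hpair : ∀ x, γ * bathOp L (OscillatorChain.bathWeight L) T φ x +
      liouvilleOp (pinnedChain ω₂ lam β γ) L χ x = -(kin L 0 x - T)) :
    T / γ ^ 2 - ∫ x, (partialP (⟨0, by omega⟩ : Fin L) φ x) ^ 2 ∂((pinnedChain ω₂ lam β γ).gibbsMeasure L T) ≤
      2 / γ * |∫ x, x.2 ⟨L - 1, by omega⟩ * partialP (⟨L - 1, by omega⟩ : Fin L) φ x
        ∂((pinnedChain ω₂ lam β γ).gibbsMeasure L T)| := by
  have h1 := certificate_pairing_hamiltonian hω hl hβ hT hL hφ hχ hφ0 hφR hpair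
  have c0 := sq_integral_momentum_mul_le hω hl hβ hT L (⟨0, by omega⟩ : Fin L) hφ0
  set A := ∫ x, x.2 ⟨0, by omega⟩ * partialP (⟨0, by omega⟩ : Fin L) φ x ∂((pinnedChain ω₂ lam β γ).gibbsMeasure L T)
    with hA
  set A' := ∫ x, x.2 ⟨L - 1, by omega⟩ * partialP (⟨L - 1, by omega⟩ : Fin L) φ x
    ∂((pinnedChain ω₂ lam β γ).gibbsMeasure L T) with hA'
  set E := ∫ x, (partialP (⟨0, by omega⟩ : Fin L) φ x) ^ 2 ∂((pinnedChain ω₂ lam β γ).gibbsMeasure L T) with hE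
  have habs : A' ≤ |A'| := le_abs_self A'
  have hγT : 0 < γ * T := mul_pos hγ hT
  -- T² − γ²T·E ≤ T² − γ²A² = T² − (T − γA')² = 2TγA' − γ²A'² ≤ 2Tγ|A'|
  have key : T ^ 2 - γ ^ 2 * T * E ≤ 2 * T * γ * |A'| := by
    have e : γ * A = T - γ * A' := by linarith
    have s1 : γ ^ 2 * A ^ 2 ≤ γ ^ 2 * (T * E) := mul_le_mul_of_nonneg_left c0 (sq_nonneg γ)
    have s2 : γ ^ 2 * A ^ 2 = (T - γ * A') ^ 2 := by rw [← e]; ring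
    have s4 : (T - γ * A') ^ 2 ≤ γ ^ 2 * (T * E) := s2 ▸ s1
    have s3 : 2 * T * γ * A' ≤ 2 * T * γ * |A'| := mul_le_mul_of_nonneg_left habs (by positivity)
    nlinarith [s4, s3, sq_nonneg (γ * A')]
  rw [div_sub' (by positivity), div_le_iff₀ (by positivity)]
  have e2 : 2 / γ * |A'| * γ ^ 2 = 2 * γ * |A'| := by field_simp
  rw [e2]
  nlinarith [key, hT]

/-- **Gain ≤ near correlation.**  For `L ≥ 2` and every admissible pair `(φ, χ)` with `χ ∈ L²(μ_T)`:
`T/γ² − ‖∂_{p_0}φ‖² ≤ (2/(γ²T)) ⟨χ, −p_0 ∂_{q_0}H⟩_{μ_T}` (from `γT⟨p_0,∂_{p_0}φ⟩ − ⟨χ,p_0∂_{q_0}H⟩ = T²` and Cauchy–Schwarz); in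
particular a gaining pair has `χ` POSITIVELY correlated with the contact kinetic-energy production. [folklore] -/
theorem certificate_gain_le_nearCorrelation (hω : 0 < ω₂) (hl : 0 ≤ lam) (hβ : 0 ≤ β) (hγ : 0 < γ) (hT : 0 < T)
    {L : ℕ} (hL : 2 ≤ L) {φ χ : PhaseSpace L → ℝ} (hφ : ContDiff ℝ 2 φ) (hχ : ContDiff ℝ 2 χ)
    (hφ0 : MemLp (partialP (⟨0, by omega⟩ : Fin L) φ) 2 ((pinnedChain ω₂ lam β γ).gibbsMeasure L T))
    (hφR : MemLp (partialP (⟨L - 1, by omega⟩ : Fin L) φ) 2 ((pinnedChain ω₂ lam β γ).gibbsMeasure L T))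
    (hχ2 : MemLp χ 2 ((pinnedChain ω₂ lam β γ).gibbsMeasure L T))
    (hpair : ∀ x, γ * bathOp L (OscillatorChain.bathWeight L) T φ x +
      liouvilleOp (pinnedChain ω₂ lam β γ) L χ x = -(kin L 0 x - T)) :
    T / γ ^ 2 - ∫ x, (partialP (⟨0, by omega⟩ : Fin L) φ x) ^ 2 ∂((pinnedChain ω₂ lam β γ).gibbsMeasure L T) ≤
      2 / (γ ^ 2 * T) * ∫ x, χ x * -(x.2 ⟨0, by omega⟩ * partialQ (⟨0, by omega⟩ : Fin L)
        ((pinnedChain ω₂ lam β γ).hamiltonian L) x) ∂((pinnedChain ω₂ lam β γ).gibbsMeasure L T) := by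
  have h2 := certificate_pairing_source hω hl hβ hT hL hφ hχ hφ0 hφR hχ2 hpair
  have c0 := sq_integral_momentum_mul_le hω hl hβ hT L (⟨0, by omega⟩ : Fin L) hφ0
  set A := ∫ x, x.2 ⟨0, by omega⟩ * partialP (⟨0, by omega⟩ : Fin L) φ x ∂((pinnedChain ω₂ lam β γ).gibbsMeasure L T)
    with hA
  set W := ∫ x, χ x * (x.2 ⟨0, by omega⟩ * partialQ (⟨0, by omega⟩ : Fin L) ((pinnedChain ω₂ lam β γ).hamiltonian L) x)
    ∂((pinnedChain ω₂ lam β γ).gibbsMeasure L T) with hW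
  set E := ∫ x, (partialP (⟨0, by omega⟩ : Fin L) φ x) ^ 2 ∂((pinnedChain ω₂ lam β γ).gibbsMeasure L T) with hE
  have hneg : ∫ x, χ x * -(x.2 ⟨0, by omega⟩ * partialQ (⟨0, by omega⟩ : Fin L)
      ((pinnedChain ω₂ lam β γ).hamiltonian L) x) ∂((pinnedChain ω₂ lam β γ).gibbsMeasure L T) = -W := by
    rw [hW, ← integral_neg]
    exact integral_congr_ae (ae_of_all _ fun x => by ring)
  rw [hneg]
  have hγT : 0 < γ * T := mul_pos hγ hT
  -- γ²T²·E ≥ γ²T·A² = (T² + W)² ≥ T⁴ + 2T²W  ⇒  T/γ² − E ≤ −2W/(γ²T)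
  have key : T ^ 3 - γ ^ 2 * T ^ 2 * E ≤ -2 * T * W := by
    have e : γ * T * A = T ^ 2 + W := by linarith
    have s1 : (γ * T) ^ 2 * A ^ 2 ≤ (γ * T) ^ 2 * (T * E) := mul_le_mul_of_nonneg_left c0 (sq_nonneg _)
    have s2 : (γ * T) ^ 2 * A ^ 2 = (T ^ 2 + W) ^ 2 := by rw [← e]; ring
    have s4 : (T ^ 2 + W) ^ 2 ≤ (γ * T) ^ 2 * (T * E) := s2 ▸ s1
    -- divide `T⁴ + 2T²W ≤ γ²T³E` by `T > 0`
    have s5 : T * (T ^ 3 + 2 * T * W) ≤ T * (γ ^ 2 * T ^ 2 * E) := by nlinarith [s4, sq_nonneg W]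
    have s6 := le_of_mul_le_mul_left s5 hT
    linarith
  rw [div_sub' (by positivity), div_le_iff₀ (by positivity)]
  have e2 : 2 / (γ ^ 2 * T) * -W * γ ^ 2 = -2 * W / T := by field_simp
  rw [e2, le_div_iff₀ hT]
  nlinarith [key, hT]

/-- **Loadings of a floor certificate.**  If an admissible pair `(φ, χ)` (`χ ∈ L²(μ_T)`) of the `L`-chain (`L ≥ 2`) has contact cost
`≤ T/γ² − c'/(L−1)`, then its far loading and its near correlation are at least of order `1/(L−1)`:
`γ c'/(2(L−1)) ≤ |⟨p_{L−1}, ∂_{p_{L−1}}φ⟩|` and `γ² T c'/(2(L−1)) ≤ ⟨χ, −p_0 ∂_{q_0}H⟩`. [folklore] -/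
theorem floorCertificate_loadings (hω : 0 < ω₂) (hl : 0 ≤ lam) (hβ : 0 ≤ β) (hγ : 0 < γ) (hT : 0 < T)
    {L : ℕ} (hL : 2 ≤ L) {c' : ℝ} {φ χ : PhaseSpace L → ℝ} (hφ : ContDiff ℝ 2 φ) (hχ : ContDiff ℝ 2 χ)
    (hφ0 : MemLp (partialP (⟨0, by omega⟩ : Fin L) φ) 2 ((pinnedChain ω₂ lam β γ).gibbsMeasure L T))
    (hφR : MemLp (partialP (⟨L - 1, by omega⟩ : Fin L) φ) 2 ((pinnedChain ω₂ lam β γ).gibbsMeasure L T))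
    (hχ2 : MemLp χ 2 ((pinnedChain ω₂ lam β γ).gibbsMeasure L T))
    (hpair : ∀ x, γ * bathOp L (OscillatorChain.bathWeight L) T φ x +
      liouvilleOp (pinnedChain ω₂ lam β γ) L χ x = -(kin L 0 x - T))
    (hcost : ((∫ x, (partialP (⟨0, by omega⟩ : Fin L) φ x) ^ 2 ∂((pinnedChain ω₂ lam β γ).gibbsMeasure L T)) +
        ∫ x, (partialP (⟨L - 1, by omega⟩ : Fin L) φ x) ^ 2 ∂((pinnedChain ω₂ lam β γ).gibbsMeasure L T)) +
      ((∫ x, (partialP (⟨0, by omega⟩ : Fin L) χ x) ^ 2 ∂((pinnedChain ω₂ lam β γ).gibbsMeasure L T)) +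
        ∫ x, (partialP (⟨L - 1, by omega⟩ : Fin L) χ x) ^ 2 ∂((pinnedChain ω₂ lam β γ).gibbsMeasure L T)) ≤
      T / γ ^ 2 - c' / ((L : ℝ) - 1)) :
    γ * c' / (2 * ((L : ℝ) - 1)) ≤ |∫ x, x.2 ⟨L - 1, by omega⟩ * partialP (⟨L - 1, by omega⟩ : Fin L) φ x
        ∂((pinnedChain ω₂ lam β γ).gibbsMeasure L T)| ∧
    γ ^ 2 * T * c' / (2 * ((L : ℝ) - 1)) ≤ ∫ x, χ x * -(x.2 ⟨0, by omega⟩ * partialQ (⟨0, by omega⟩ : Fin L)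
        ((pinnedChain ω₂ lam β γ).hamiltonian L) x) ∂((pinnedChain ω₂ lam β γ).gibbsMeasure L T) := by
  have gF := certificate_gain_le_farLoading hω hl hβ hγ hT hL hφ hχ hφ0 hφR hpair
  have gN := certificate_gain_le_nearCorrelation hω hl hβ hγ hT hL hφ hχ hφ0 hφR hχ2 hpair
  have hLpos : (0 : ℝ) < (L : ℝ) - 1 := by
    have : (2 : ℝ) ≤ L := by exact_mod_cast hL
    linarith
  have hE1 : 0 ≤ ∫ x, (partialP (⟨L - 1, by omega⟩ : Fin L) φ x) ^ 2 ∂((pinnedChain ω₂ lam β γ).gibbsMeasure L T) :=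
    integral_nonneg fun x => sq_nonneg _
  have hE2 : 0 ≤ ∫ x, (partialP (⟨0, by omega⟩ : Fin L) χ x) ^ 2 ∂((pinnedChain ω₂ lam β γ).gibbsMeasure L T) :=
    integral_nonneg fun x => sq_nonneg _
  have hE3 : 0 ≤ ∫ x, (partialP (⟨L - 1, by omega⟩ : Fin L) χ x) ^ 2 ∂((pinnedChain ω₂ lam β γ).gibbsMeasure L T) :=
    integral_nonneg fun x => sq_nonneg _
  -- the gain is at least c'/(L−1)
  have hgain : c' / ((L : ℝ) - 1) ≤
      T / γ ^ 2 - ∫ x, (partialP (⟨0, by omega⟩ : Fin L) φ x) ^ 2 ∂((pinnedChain ω₂ lam β γ).gibbsMeasure L T) := by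
    linarith
  constructor
  · -- c'/(L−1) ≤ (2/γ)|A'|
    have h := hgain.trans gF
    rw [div_le_iff₀ (by positivity)]
    have := (div_le_iff₀ hLpos).mp (le_trans h (le_refl _))
    -- c' ≤ (2/γ)|A'| (L−1)  ⇒  γ c' ≤ 2 |A'| (L−1)
    have e : 2 / γ * |∫ x, x.2 ⟨L - 1, by omega⟩ * partialP (⟨L - 1, by omega⟩ : Fin L) φ x
        ∂((pinnedChain ω₂ lam β γ).gibbsMeasure L T)| * ((L : ℝ) - 1) * γ =
        |∫ x, x.2 ⟨L - 1, by omega⟩ * partialP (⟨L - 1, by omega⟩ : Fin L) φ x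
          ∂((pinnedChain ω₂ lam β γ).gibbsMeasure L T)| * (2 * ((L : ℝ) - 1)) := by
      field_simp
    nlinarith [this, e, hγ]
  · have h := hgain.trans gN
    rw [div_le_iff₀ (by positivity)]
    have := (div_le_iff₀ hLpos).mp h
    have e : 2 / (γ ^ 2 * T) * (∫ x, χ x * -(x.2 ⟨0, by omega⟩ * partialQ (⟨0, by omega⟩ : Fin L)
        ((pinnedChain ω₂ lam β γ).hamiltonian L) x) ∂((pinnedChain ω₂ lam β γ).gibbsMeasure L T)) * ((L : ℝ) - 1) *
        (γ ^ 2 * T) =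
        (∫ x, χ x * -(x.2 ⟨0, by omega⟩ * partialQ (⟨0, by omega⟩ : Fin L)
          ((pinnedChain ω₂ lam β γ).hamiltonian L) x) ∂((pinnedChain ω₂ lam β γ).gibbsMeasure L T)) * (2 * ((L : ℝ) - 1)) := by
      field_simp
    have hγ2T : 0 < γ ^ 2 * T := by positivity
    nlinarith [this, e, hγ2T]

/-- Registered helper sub-goal `helper_floorCertificateLoadings` of stub `stub_transmissionGradientFloor`
(= `floorCertificate_loadings` in closed form; line ForecastSensitivitySketch, crux stmt-AtomisticToContinuum-11749). [folklore] -/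
theorem helper_floorCertificateLoadings : ∀ {ω₂ lam β γ T : ℝ}, 0 < ω₂ → 0 ≤ lam → 0 ≤ β → 0 < γ → 0 < T → ∀ {L : ℕ} (hL : 2 ≤ L) {c' : ℝ} {φ χ : PhaseSpace L → ℝ}, ContDiff ℝ 2 φ → ContDiff ℝ 2 χ → MemLp (partialP (⟨0, by omega⟩ : Fin L) φ) 2 ((pinnedChain ω₂ lam β γ).gibbsMeasure L T) → MemLp (partialP (⟨L - 1, by omega⟩ : Fin L) φ) 2 ((pinnedChain ω₂ lam β γ).gibbsMeasure L T) → MemLp χ 2 ((pinnedChain ω₂ lam β γ).gibbsMeasure L T) → (∀ x, γ * bathOp L (OscillatorChain.bathWeight L) T φ x + liouvilleOp (pinnedChain ω₂ lam β γ) L χ x = -(kin L 0 x - T)) → ((∫ x, (partialP (⟨0, by omega⟩ : Fin L) φ x) ^ 2 ∂((pinnedChain ω₂ lam β γ).gibbsMeasure L T)) + ∫ x, (partialP (⟨L - 1, by omega⟩ : Fin L) φ x) ^ 2 ∂((pinnedChain ω₂ lam β γ).gibbsMeasure L T)) + ((∫ x, (partialP (⟨0, by omega⟩ : Fin L) χ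 x) ^ 2 ∂((pinnedChain ω₂ lam β γ).gibbsMeasure L T)) + ∫ x, (partialP (⟨L - 1, by omega⟩ : Fin L) χ x) ^ 2 ∂((pinnedChain ω₂ lam β γ).gibbsMeasure L T)) ≤ T / γ ^ 2 - c' / ((L : ℝ) - 1) → γ * c' / (2 * ((L : ℝ) - 1)) ≤ |∫ x, x.2 ⟨L - 1, by omega⟩ * partialP (⟨L - 1, by omega⟩ : Fin L) φ x ∂((pinnedChain ω₂ lam β γ).gibbsMeasure L T)| ∧ γ ^ 2 * T * c' / (2 * ((L : ℝ) - 1)) ≤ ∫ x, χ x * -(x.2 ⟨0, by omega⟩ * partialQ (⟨0, by omega⟩ : Fin L) ((pinnedChain ω₂ lam β γ).hamiltonian L) x) ∂((pinnedChain ω₂ lam β γ).gibbsMeasure L T) :=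
  @floorCertificate_loadings

end Summit.AtomisticToContinuum.FouriersLaw.Cruxes.ConductanceLowerBound.ForecastSensitivity

end
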